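import Summits.AtomisticToContinuum.HydrodynamicLimit.Theorems.TwoClocksClampedWindowDockActivityInversion
import Summits.AtomisticToContinuum.HydrodynamicLimit.Theorems.TwoClocksClampedWindowDockReferenceLLN
import Summits.AtomisticToContinuum.HydrodynamicLimit.Theorems.JaynesSqueezeHardSphereLDAMeanLimit
import Summits.AtomisticToContinuum.HydrodynamicLimit.Theorems.OneFlightGossipEngineClampedCurrentsDockEos
import Summits.AtomisticToContinuum.HydrodynamicLimit.Theorems.OneFlightGossipEngineClampedCurrentsDockLogPartition
import Summits.AtomisticToContinuum.HydrodynamicLimit.Theorems.ImplosionDichotomyPolynomialCompressionIdealGasBridge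
import Literature.Analysis.FunctionSpaces.TorusChainRule
import Literature.Analysis.FunctionSpaces.TorusSpaceTimeComposition
import HarnessLib

/-!
# The static channel of the entropy ledger along the explicit reference activity (stub `stub_staticLimit`,
# line `IdeatorTwoSketch`, crux `ClampedCurrentsDock`, stmt-AtomisticToContinuum-14680)

Helper file (`--supports stmt-AtomisticToContinuum-14680`) proving the registered stub `stub_staticLimit : StaticLimit`
(SC-b, skeleton v24 §1d of `Cruxes/ClampedCurrentsDock/Lines/IdeatorTwoSketch.lean`; finding `STATIC-TELESCOPING.md` there).
Along a classical hard-sphere Euler solution `(ρ, u, θ)` on `[0,T)` in band (`ρσ³ < ηs`) with unit mass, the explicit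
reference activity `a_s = ρ_s · Rf(σ³ρ_s)` (`Rf` the analytic insertion factor of the activity inversion) satisfies:
(i) `a` is jointly smooth on `[0,T) × 𝕋³` (`ρ` is, `Rf` is analytic on `(−r, r) ∋ σ³ρ`); (ii) `a > 0`;
(iii) `Z_pos(a_s) > 0`; (iv) `Cst(s) = ∫ ρ_s η Z′(η) div u_s` (`η = ρ_s σ³`, `Z = hsCompressibility`) is continuous on
`[0,t]` (on the EOS window of S4 `Z` is the real-analytic `1 + ηF′`); (v) the canonical means
`D_N(r) = Z_pos⁻¹ ∫ posWeight(a_r) Σᵢ ∂_r log a_r(xᵢ)` are `O(N+1)` uniformly on `[0,t]` (`∂_r log a_r` is bounded on the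
compact slab); (vi) `D_N(r)/(N+1) → −Cst(r)`: `D_N(r)/(N+1)` is the mean of the empirical density field of
`χ_r = ∂_r log a_r` under the configurational Gibbs measure of `a_r`, which is in the statics regime with limit density
`ρ_r` (`EntropyClockDock.activity_of_density`), so it tends to `∫ χ_r ρ_r` (`HardSphereLDA.tendsto_gibbsMean_of_smallDensity`,
the one-body mean LLN); and `∫ χ_r ρ_r = −Cst(r)` is calculus: `∂_r log a_r = (Z + ηZ′)(σ³ρ_r) ∂_rρ_r/ρ_r`
(S4: `1 + η(log Rf)′ = Z + ηZ′`), `∂_rρ = −div(ρu)` (continuity equation), and pointwise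
`(Z + ηZ′) div(ρu) = ρηZ′ div u + div(ρZ(σ³ρ) u)` (`(pZ(σ³p))′ = Z + ηZ′`), the last divergence integrating to zero.
-/

noncomputable section

namespace Summit.AtomisticToContinuum.HydrodynamicLimit.Theorems.ClampedCurrentsDockStaticLimit

open scoped BigOperators ENNReal Classical Interval
open MeasureTheory Filter Set Topology InformationTheory
open Literature.MathematicalPhysics.KineticTheory Literature.Analysis.FluidPDE Literature.Analysis.FunctionSpaces
open Summit.AtomisticToContinuum.HydrodynamicLimit.Theorems

/-- registered stub signature SC-b of line IdeatorTwoSketch, crux ClampedCurrentsDock — route-internal, not a cited fact -/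
def StaticLimit : Prop :=
  ∀ (r : ℝ) (Rf : ℝ → ℝ), 0 < r →
    (∃ p : FormalMultilinearSeries ℝ ℝ ℝ, HasFPowerSeriesOnBall Rf p 0 (ENNReal.ofReal r)) →
    (∃ L : NNReal, LipschitzOnWith L Rf (Icc 0 r)) →
    (∀ x ∈ Ioo (-r) r, 0 < Rf x ∧ Rf x * (∑' j : ℕ, bE j / (j.factorial : ℝ) * (x * Rf x) ^ j) = 1) →
    (∀ x ∈ Icc 0 r, 1 ≤ Rf x ∧ Rf x ≤ 2) → ContinuousOn Rf (Icc 0 r) →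
    (∀ x ∈ Ioo (-r) r, ∀ R ∈ Icc (1 / 2 : ℝ) 2,
      R * (∑' j : ℕ, bE j / (j.factorial : ℝ) * (x * R) ^ j) = 1 → R = Rf x) →
    ∃ ηs : ℝ, 0 < ηs ∧ ∀ σ : ℝ, 0 < σ → σ < 1 / 2 →
    ∀ (T : ℝ) (ρ θ : ℝ → T3 → ℝ) (u : ℝ → T3 → V3), IsHardSphereEulerSolution σ T ρ u θ →
    (∀ s ∈ Ico 0 T, ∀ x, ρ s x * σ ^ 3 < ηs) → (∀ s ∈ Ico 0 T, ∫ x, ρ s x = 1) →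
    ∀ Φ : (N : ℕ) → HardSphereFlow (Torus.geometry (Fin 3)) (hsDiameter σ N) (N + 1), ∀ t ∈ Ioo 0 T,
      (let a := fun (s : ℝ) (x : T3) => ρ s x * Rf (σ ^ 3 * ρ s x)
       let Cst := fun (s : ℝ) => ∫ x, ρ s x * (ρ s x * σ ^ 3) * deriv hsCompressibility (ρ s x * σ ^ 3) *
         Torus.divergence (u s) x
       let D := fun (N : ℕ) (r : ℝ) => (posPartition (a r) (hsDiameter σ N) (N + 1))⁻¹ *
         ∫ x : Fin (N + 1) → T3, posWeight (a r) (hsDiameter σ N) (N + 1) x *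
           ∑ i, Torus.timeDerivWithin (Ico 0 T) a r (x i) / a r (x i)
       Torus.IsSmoothSpaceTimeOn (Ico 0 T) a ∧ (∀ s ∈ Ico 0 T, ∀ x, 0 < a s x) ∧
       (∀ (N : ℕ), ∀ s ∈ Ico 0 T, 0 < posPartition (a s) (hsDiameter σ N) (N + 1)) ∧
       ContinuousOn Cst (Icc 0 t) ∧
       (∃ M : ℝ, ∀ (N : ℕ), ∀ r ∈ Icc 0 t, |D N r| ≤ ((N : ℝ) + 1) * M) ∧
       (∀ r ∈ Icc 0 t, Tendsto (fun N : ℕ => D N r / ((N : ℝ) + 1)) atTop (𝓝 (-Cst r))))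

open scoped ContDiff

/-! ### §1 The EOS window: an analytic compressibility and the logarithmic derivative of the insertion factor -/

section Eos

variable {r : ℝ} {Rf : ℝ → ℝ}

/-- **The EOS window of S4, in the form used by the static channel.** An insertion factor `Rf` with a power series of
radius `r` at `0` is analytic on `(−r, r)`, and (given the four defining properties) there are `η₁ ∈ (0, r]` and a
real-analytic `Zs` on `(−η₁, η₁)` with
`hsCompressibility = Zs` and `deriv hsCompressibility = deriv Zs` on `(0, η₁)` (`Z = 1 + ηF′` there, `F` the analytic
germ of `hsExcessFreeEnergy`), `Rf` differentiable on `(0, η₁)` with `Rf′ = Rf · (log Rf)′`, and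
`1 + η (log Rf)′(η) = Zs(η) + η Zs′(η)` (`(log Rf)′ = 2F′ + ηF″`, `ClampedCurrentsDockEos.stub_eos`). [folklore] -/
theorem eos_window (hr : 0 < r)
    (hps : ∃ p : FormalMultilinearSeries ℝ ℝ ℝ, HasFPowerSeriesOnBall Rf p 0 (ENNReal.ofReal r))
    (hsol : ∀ x ∈ Ioo (-r) r, 0 < Rf x ∧ Rf x * (∑' j : ℕ, bE j / (j.factorial : ℝ) * (x * Rf x) ^ j) = 1)
    (hbd : ∀ x ∈ Icc 0 r, 1 ≤ Rf x ∧ Rf x ≤ 2) (hcont : ContinuousOn Rf (Icc 0 r))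
    (huniq : ∀ x ∈ Ioo (-r) r, ∀ R ∈ Icc (1 / 2 : ℝ) 2,
      R * (∑' j : ℕ, bE j / (j.factorial : ℝ) * (x * R) ^ j) = 1 → R = Rf x) :
    AnalyticOnNhd ℝ Rf (Ioo (-r) r) ∧ ∃ η₁ : ℝ, 0 < η₁ ∧ η₁ ≤ r ∧ ∃ Zs : ℝ → ℝ, AnalyticOnNhd ℝ Zs (Ioo (-η₁) η₁) ∧
      (∀ η ∈ Ioo 0 η₁, hsCompressibility η = Zs η) ∧
      (∀ η ∈ Ioo 0 η₁, deriv hsCompressibility η = deriv Zs η) ∧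
      (∀ η ∈ Ioo 0 η₁, HasDerivAt Rf (Rf η * deriv (fun x => Real.log (Rf x)) η) η) ∧
      (∀ η ∈ Ioo 0 η₁, 1 + η * deriv (fun x => Real.log (Rf x)) η = Zs η + η * deriv Zs η) := by
  obtain ⟨η₁, hη₁, hη₁r, F, hFan, hEq, hd⟩ := ClampedCurrentsDockEos.stub_eos r Rf hr hsol hbd hcont huniq
  obtain ⟨p, hp⟩ := hps
  have hRfan : AnalyticOnNhd ℝ Rf (Ioo (-r) r) := by
    have := hp.analyticOnNhd
    rwa [Metric.eball_ofReal, Real.ball_eq_Ioo, zero_sub, zero_add] at this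
  set Zs : ℝ → ℝ := fun η => 1 + η * deriv F η with hZs
  have hZan : AnalyticOnNhd ℝ Zs (Ioo (-η₁) η₁) := analyticOnNhd_const.add (analyticOnNhd_id.mul hFan.deriv)
  have hZeq : ∀ η ∈ Ioo 0 η₁, hsCompressibility η = Zs η := by
    intro η hη
    have hev : hsExcessFreeEnergy =ᶠ[𝓝 η] F :=
      (hEq.mono Ioo_subset_Ico_self).eventuallyEq_of_mem (Ioo_mem_nhds hη.1 hη.2)
    rw [hsCompressibility, hev.deriv_eq]
  refine ⟨hRfan, η₁, hη₁, hη₁r, Zs, hZan, hZeq, fun η hη => ?_, fun η hη => ?_, fun η hη => ?_⟩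
  · have hev : hsCompressibility =ᶠ[𝓝 η] Zs := by
      filter_upwards [Ioo_mem_nhds hη.1 hη.2] with y hy using hZeq y hy
    exact hev.deriv_eq
  · have hηr : η ∈ Ioo (-r) r := ⟨by linarith [hη.1], hη.2.trans_le hη₁r⟩
    have h1 : HasDerivAt Rf (deriv Rf η) η := (hRfan η hηr).differentiableAt.hasDerivAt
    have h2 := h1.log (hsol η hηr).1.ne'
    rw [h2.deriv, mul_div_cancel₀ _ (hsol η hηr).1.ne']
    exact h1
  · have hη' : η ∈ Ioo (-η₁) η₁ := ⟨by linarith [hη.1], hη.2⟩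
    have hF'd : HasDerivAt (deriv F) (deriv (deriv F) η) η :=
      (hFan.deriv η hη').differentiableAt.hasDerivAt
    have hZd : HasDerivAt Zs (1 * deriv F η + η * deriv (deriv F) η) η :=
      ((hasDerivAt_id η).mul hF'd).const_add 1
    rw [(hd η hη).2, hZd.deriv, hZs]
    ring

end Eos

/-! ### §2 The reference activity `a = ρ · Rf(σ³ρ)`: smoothness and logarithmic time derivative -/

section Activity

variable {σ : ℝ} {S : Set ℝ} {ρ a : ℝ → T3 → ℝ} {Rf : ℝ → ℝ} {r : ℝ}

/-- The reference activity is jointly smooth on the slab when `ρ` is and `σ³ρ` stays in the analyticity window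
`(−r, r)` of `Rf`. [folklore] -/
theorem isSmoothSpaceTimeOn_activity (hρ : Torus.IsSmoothSpaceTimeOn S ρ) (hRf : ContDiffOn ℝ ∞ Rf (Ioo (-r) r))
    (hmaps : ∀ s ∈ S, ∀ x, σ ^ 3 * ρ s x ∈ Ioo (-r) r) (ha : ∀ s x, a s x = ρ s x * Rf (σ ^ 3 * ρ s x)) :
    Torus.IsSmoothSpaceTimeOn S a := by
  have h1 : Torus.IsSmoothSpaceTimeOn S (fun s x => σ ^ 3 * ρ s x) :=
    (Torus.isSmoothSpaceTimeOn_const (Torus.isSmooth_const (σ ^ 3)) S).mul hρ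
  have h2 : Torus.IsSmoothSpaceTimeOn S (fun s x => Rf (σ ^ 3 * ρ s x)) := h1.comp_contDiffOn hRf hmaps
  have hfun : a = fun s x => ρ s x * Rf (σ ^ 3 * ρ s x) := funext fun s => funext fun x => ha s x
  rw [hfun]
  exact hρ.mul h2

/-- **Logarithmic time derivative of the reference activity** (product and chain rule within the time set):
`∂_s a / a = (1 + η ℓ) · ∂_s ρ / ρ` at `(s, x)`, where `η = σ³ρ_s(x)` and `Rf′(η) = Rf(η) ℓ`. [folklore] -/
theorem timeDerivWithin_activity_div (hρ : Torus.IsSmoothSpaceTimeOn S ρ) {s : ℝ} (hs : s ∈ S)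
    (hS : UniqueDiffWithinAt ℝ S s) (x : T3) (ha : ∀ s x, a s x = ρ s x * Rf (σ ^ 3 * ρ s x)) {ℓ : ℝ}
    (hRf : HasDerivAt Rf (Rf (σ ^ 3 * ρ s x) * ℓ) (σ ^ 3 * ρ s x)) (hρ0 : ρ s x ≠ 0)
    (hRf0 : Rf (σ ^ 3 * ρ s x) ≠ 0) :
    Torus.timeDerivWithin S a s x / a s x = (1 + σ ^ 3 * ρ s x * ℓ) * (Torus.timeDerivWithin S ρ s x / ρ s x) := by
  have hρ' := hρ.hasDerivWithinAt_slice hs x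
  have hin : HasDerivWithinAt (fun τ => σ ^ 3 * ρ τ x) (σ ^ 3 * Torus.timeDerivWithin S ρ s x) S s :=
    hρ'.const_mul (σ ^ 3)
  have hprod : HasDerivWithinAt (fun τ => ρ τ x * Rf (σ ^ 3 * ρ τ x)) (Torus.timeDerivWithin S ρ s x *
      Rf (σ ^ 3 * ρ s x) + ρ s x * (Rf (σ ^ 3 * ρ s x) * ℓ * (σ ^ 3 * Torus.timeDerivWithin S ρ s x))) S s :=
    hρ'.mul (hRf.comp_hasDerivWithinAt s hin)
  have hfun : (fun τ => a τ x) = fun τ => ρ τ x * Rf (σ ^ 3 * ρ τ x) := funext fun τ => ha τ x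
  have hderiv : Torus.timeDerivWithin S a s x = Torus.timeDerivWithin S ρ s x * Rf (σ ^ 3 * ρ s x) +
      ρ s x * (Rf (σ ^ 3 * ρ s x) * ℓ * (σ ^ 3 * Torus.timeDerivWithin S ρ s x)) := by
    show derivWithin (fun τ => a τ x) S s = _
    rw [hfun, hprod.derivWithin hS]
  rw [hderiv, ha s x]
  field_simp

end Activity

/-! ### §3 Torus calculus of the static channel: `(Z + ηZ′) div(ρu) = ρηZ′ div u + div(ρ Z(σ³ρ) u)` -/

section TorusCalc

variable {σ : ℝ} {ρ₀ : T3 → ℝ} {u₀ : T3 → V3} {Zs : ℝ → ℝ} {V : Set ℝ}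

/-- `p ↦ p · Zs(σ³p)` has derivative `Zs(η) + η Zs′(η)` at `p`, `η = σ³p`, wherever `Zs` is differentiable at `η`.
[folklore] -/
theorem hasDerivAt_mul_comp (p : ℝ) (hZ : DifferentiableAt ℝ Zs (σ ^ 3 * p)) :
    HasDerivAt (fun q => q * Zs (σ ^ 3 * q)) (Zs (σ ^ 3 * p) + σ ^ 3 * p * deriv Zs (σ ^ 3 * p)) p := by
  have h1 : HasDerivAt (fun q => σ ^ 3 * q) (σ ^ 3 * 1) p := (hasDerivAt_id p).const_mul (σ ^ 3)
  have h3 : HasDerivAt (fun q => q * Zs (σ ^ 3 * q))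
      (1 * Zs (σ ^ 3 * p) + p * (deriv Zs (σ ^ 3 * p) * (σ ^ 3 * 1))) p :=
    (hasDerivAt_id p).mul (hZ.hasDerivAt.comp p h1)
  exact h3.congr_deriv (by ring)

/-- **The pointwise divergence identity of the static channel.** For `C¹` torus fields `ρ₀`, `u₀` (and
`ρ₀ Zs(σ³ρ₀)`) and `Zs` differentiable at `η = σ³ρ₀(x)`:
`(Zs η + η Zs′ η) · div(ρ₀u₀)(x) = ρ₀ η Zs′(η) div u₀(x) + div((ρ₀ Zs(σ³ρ₀)) u₀)(x)` (product rules and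
`∂ᵢ(ρ₀ Zs(σ³ρ₀)) = (Zs + ηZs′) ∂ᵢρ₀`). [folklore] -/
theorem static_divergence_identity (hρ : Torus.IsContDiff 1 ρ₀) (hu : Torus.IsContDiff 1 u₀)
    (hH : Torus.IsContDiff 1 (fun y => ρ₀ y * Zs (σ ^ 3 * ρ₀ y))) (x : T3)
    (hZ : DifferentiableAt ℝ Zs (σ ^ 3 * ρ₀ x)) :
    (Zs (σ ^ 3 * ρ₀ x) + σ ^ 3 * ρ₀ x * deriv Zs (σ ^ 3 * ρ₀ x)) *
        Torus.divergence (fun y => ρ₀ y • u₀ y) x =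
      ρ₀ x * (σ ^ 3 * ρ₀ x) * deriv Zs (σ ^ 3 * ρ₀ x) * Torus.divergence u₀ x +
        Torus.divergence (fun y => (ρ₀ y * Zs (σ ^ 3 * ρ₀ y)) • u₀ y) x := by
  have hdH : ∀ i, Torus.partialDeriv i (fun y => ρ₀ y * Zs (σ ^ 3 * ρ₀ y)) x =
      (Zs (σ ^ 3 * ρ₀ x) + σ ^ 3 * ρ₀ x * deriv Zs (σ ^ 3 * ρ₀ x)) * Torus.partialDeriv i ρ₀ x :=
    fun i => partialDeriv_comp_of_hasDerivAt (φ := fun q => q * Zs (σ ^ 3 * q)) hρ x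
      (hasDerivAt_mul_comp (ρ₀ x) hZ) i
  rw [Torus.divergence_smul hH hu, Torus.divergence_smul hρ hu]
  simp_rw [hdH]
  have hsum : ∑ i, u₀ x i * ((Zs (σ ^ 3 * ρ₀ x) + σ ^ 3 * ρ₀ x * deriv Zs (σ ^ 3 * ρ₀ x)) *
      Torus.partialDeriv i ρ₀ x) = (Zs (σ ^ 3 * ρ₀ x) + σ ^ 3 * ρ₀ x * deriv Zs (σ ^ 3 * ρ₀ x)) *
        ∑ i, u₀ x i * Torus.partialDeriv i ρ₀ x := by
    rw [Finset.mul_sum]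
    exact Finset.sum_congr rfl fun i _ => by ring
  rw [hsum]
  ring

/-- `y ↦ ρ₀(y) Zs(σ³ρ₀(y))` is smooth on the torus when `ρ₀` is and `Zs` is smooth on an open set containing the values
`σ³ρ₀`. [folklore] -/
theorem isSmooth_mul_comp (hρ : Torus.IsSmooth ρ₀) (hZ : ContDiffOn ℝ ∞ Zs V) (hmaps : ∀ x, σ ^ 3 * ρ₀ x ∈ V) :
    Torus.IsSmooth (fun y => ρ₀ y * Zs (σ ^ 3 * ρ₀ y)) := by
  have h1 : Torus.IsSmooth (fun y => Zs (σ ^ 3 * ρ₀ y)) := by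
    have h : Torus.lift (fun y => Zs (σ ^ 3 * ρ₀ y)) = Zs ∘ fun v => σ ^ 3 * Torus.lift ρ₀ v := by
      funext v; rfl
    unfold Torus.IsSmooth
    rw [h]
    exact hZ.comp_contDiff (contDiff_const.mul hρ) fun v => hmaps _
  exact hρ.smul' h1

/-- **The static-channel integral identity on `𝕋³`.** For smooth `ρ₀`, `u₀` and `Zs` smooth on an open `V`
containing the values `σ³ρ₀`: `∫ (Zs + ηZs′)(σ³ρ₀) div(ρ₀u₀) = ∫ ρ₀ (σ³ρ₀) Zs′(σ³ρ₀) div u₀` (the divergence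
`div((ρ₀Zs(σ³ρ₀)) u₀)` integrates to zero over the torus). [folklore] -/
theorem static_integral_identity (hρ : Torus.IsSmooth ρ₀) (hu : Torus.IsSmooth u₀) (hV : IsOpen V)
    (hZ : ContDiffOn ℝ ∞ Zs V) (hmaps : ∀ x, σ ^ 3 * ρ₀ x ∈ V) :
    ∫ x, (Zs (σ ^ 3 * ρ₀ x) + σ ^ 3 * ρ₀ x * deriv Zs (σ ^ 3 * ρ₀ x)) *
        Torus.divergence (fun y => ρ₀ y • u₀ y) x =
      ∫ x, ρ₀ x * (σ ^ 3 * ρ₀ x) * deriv Zs (σ ^ 3 * ρ₀ x) * Torus.divergence u₀ x := by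
  have hH := isSmooth_mul_comp hρ hZ hmaps
  have hZd : ∀ x, DifferentiableAt ℝ Zs (σ ^ 3 * ρ₀ x) := fun x =>
    (hZ.differentiableOn (by simp)).differentiableAt (hV.mem_nhds (hmaps x))
  have hpt : ∀ x, (Zs (σ ^ 3 * ρ₀ x) + σ ^ 3 * ρ₀ x * deriv Zs (σ ^ 3 * ρ₀ x)) *
      Torus.divergence (fun y => ρ₀ y • u₀ y) x =
        ρ₀ x * (σ ^ 3 * ρ₀ x) * deriv Zs (σ ^ 3 * ρ₀ x) * Torus.divergence u₀ x +
          Torus.divergence (fun y => (ρ₀ y * Zs (σ ^ 3 * ρ₀ y)) • u₀ y) x := fun x =>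
    static_divergence_identity (hρ.isContDiff (by simp)) (hu.isContDiff (by simp)) (hH.isContDiff (by simp)) x
      (hZd x)
  simp_rw [hpt]
  have hZ'c : Continuous fun x => deriv Zs (σ ^ 3 * ρ₀ x) :=
    (hZ.continuousOn_deriv_of_isOpen hV (by simp)).comp_continuous (continuous_const.mul hρ.continuous) hmaps
  have hi1 : Integrable fun x => ρ₀ x * (σ ^ 3 * ρ₀ x) * deriv Zs (σ ^ 3 * ρ₀ x) * Torus.divergence u₀ x :=
    integrable_of_continuous_T3
      (((hρ.continuous.mul (continuous_const.mul hρ.continuous)).mul hZ'c).mul hu.divergence.continuous)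
  rw [integral_add hi1 ((hH.smul' hu).divergence).integrable,
    Torus.integral_divergence_eq_zero_holds (hH.smul' hu), add_zero]

end TorusCalc

/-! ### §4 Canonical means of one-body sums: a uniform bound and the mean LLN -/

section Means

variable {a₀ : T3 → ℝ} {σ : ℝ} {χ : T3 → ℝ}

/-- **Uniform bound of the canonical mean of a one-body sum**: `|Z_pos⁻¹ ∫ posWeight(a₀) Σᵢ χ(xᵢ)| ≤ (N+1) sup|χ|`
(the left side is the expectation of `Σᵢ χ(xᵢ)` under the configurational Gibbs probability measure). [folklore] -/
theorem abs_mean_sum_le (ha : Continuous a₀) (ha0 : ∀ x, 0 < a₀ x) (hσ2 : σ ≤ 1 / 2) {M : ℝ}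
    (hχ : ∀ y, |χ y| ≤ M) (N : ℕ) :
    |(posPartition a₀ (hsDiameter σ N) (N + 1))⁻¹ *
        ∫ x : Fin (N + 1) → T3, posWeight a₀ (hsDiameter σ N) (N + 1) x * ∑ i, χ (x i)| ≤
      ((N : ℝ) + 1) * M := by
  haveI := isProbabilityMeasure_posGibbsMeasure ha ha0 hσ2 N
  rw [← HardSphereLDA.integral_posGibbsMeasure ha.measurable (fun y => (ha0 y).le), ← Real.norm_eq_abs]
  have h := norm_integral_le_of_norm_le_const (μ := posGibbsMeasure a₀ (hsDiameter σ N) (N + 1))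
    (f := fun x : Fin (N + 1) → T3 => ∑ i, χ (x i)) (C := ((N : ℝ) + 1) * M)
    (ae_of_all _ fun x => by
      rw [Real.norm_eq_abs, ← Nat.cast_add_one]
      exact abs_sum_apply_le hχ x)
  rwa [probReal_univ, mul_one] at h

/-- **The mean of the empirical density field under the reference Gibbs measure in the statics regime**:
`Z_pos⁻¹ ∫ posWeight(a₀) Σᵢ χ(xᵢ) / (N+1) → ∫ χ · rhoLim (profileOf a₀) σ`
(`HardSphereLDA.tendsto_gibbsMean_of_smallDensity`). [folklore] -/
theorem tendsto_mean_sum_div (ha : Continuous a₀) (ha0 : ∀ x, 0 < a₀ x)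
    (h : SmallDensity (profileOf a₀ ha ha0) σ) (hχ : Continuous χ) :
    Tendsto (fun N : ℕ => (posPartition a₀ (hsDiameter σ N) (N + 1))⁻¹ *
        (∫ x : Fin (N + 1) → T3, posWeight a₀ (hsDiameter σ N) (N + 1) x * ∑ i, χ (x i)) / ((N : ℝ) + 1))
      atTop (𝓝 (∫ y, χ y * rhoLim (profileOf a₀ ha ha0) σ y)) := by
  refine (HardSphereLDA.tendsto_gibbsMean_of_smallDensity ha ha0 h hχ).congr fun N => ?_
  rw [Nat.cast_add_one, mul_div_assoc, ← integral_div]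
  congr 1
  refine integral_congr_ae (ae_of_all _ fun x => ?_)
  simp only
  ring

end Means

/-! ### §5 The stub -/

/-- **STUB SC-b `stub_staticLimit`** of line `IdeatorTwoSketch` (crux `ClampedCurrentsDock`, stmt-AtomisticToContinuum-14680):
the statics half of the static telescoping — smoothness and positivity of the explicit reference activity `a = ρ Rf(σ³ρ)`,
`Z_pos > 0`, continuity of `Cst`, the uniform bound and the pointwise limit `D_N(r)/(N+1) → −Cst(r)` of the canonical means.
[folklore] -/
theorem stub_staticLimit : StaticLimit := by
  intro r Rf hr hps hLip hsol hbd hcont huniq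
  -- the analyticity of `Rf` and the EOS window (S4)
  obtain ⟨hRfan, η₁, hη₁, hη₁r, Zs, hZan, -, hZd, hRfd, hid⟩ := eos_window hr hps hsol hbd hcont huniq
  have hRfcd : ContDiffOn ℝ ∞ Rf (Ioo (-r) r) := hRfan.contDiffOn_of_completeSpace
  have hZcd : ContDiffOn ℝ ∞ Zs (Ioo (-η₁) η₁) := hZan.contDiffOn_of_completeSpace
  have hZ'cd : ContDiffOn ℝ ∞ (deriv Zs) (Ioo (-η₁) η₁) := hZan.deriv.contDiffOn_of_completeSpace
  -- the in-band threshold: activity inversion and the EOS window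
  set ηA : ℝ := min (r / (2 * (2 * (2 * Real.exp 1 + 1)))) (1 / (64 * Real.exp 1 * v₁)) with hηA
  have hηA0 : 0 < ηA := lt_min (by positivity) (by have := v₁_pos; positivity)
  refine ⟨min ηA η₁, lt_min hηA0 hη₁, ?_⟩
  intro σ hσ hσ2 T ρ θ u hE hguard hmass Φ t ht a Cst D
  have ha : ∀ s x, a s x = ρ s x * Rf (σ ^ 3 * ρ s x) := fun _ _ => rfl
  have hσ3 : 0 < σ ^ 3 := pow_pos hσ 3
  have hU : UniqueDiffOn ℝ (Ico 0 T) := uniqueDiffOn_Ico 0 T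
  have htT : Icc 0 t ⊆ Ico 0 T := fun s hs => ⟨hs.1, hs.2.trans_lt ht.2⟩
  -- the range of `η = σ³ρ` on the slab
  have hη : ∀ s ∈ Ico 0 T, ∀ x, σ ^ 3 * ρ s x ∈ Ioo 0 η₁ := fun s hs x =>
    ⟨mul_pos hσ3 (hE.density_pos s hs x), by
      rw [mul_comm]
      exact (hguard s hs x).trans_le (min_le_right _ _)⟩
  have hηV : ∀ s ∈ Ico 0 T, ∀ x, σ ^ 3 * ρ s x ∈ Ioo (-η₁) η₁ := fun s hs x =>
    ⟨by linarith [(hη s hs x).1], (hη s hs x).2⟩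
  have hηr : ∀ s ∈ Ico 0 T, ∀ x, σ ^ 3 * ρ s x ∈ Ioo (-r) r := fun s hs x =>
    ⟨by linarith [(hη s hs x).1], (hη s hs x).2.trans_le hη₁r⟩
  have hRf1 : ∀ s ∈ Ico 0 T, ∀ x, 1 ≤ Rf (σ ^ 3 * ρ s x) := fun s hs x =>
    (hbd _ ⟨(hη s hs x).1.le, ((hη s hs x).2.trans_le hη₁r).le⟩).1
  -- (i) smoothness, (ii) positivity, (iii) `Z_pos > 0`
  have hsm : Torus.IsSmoothSpaceTimeOn (Ico 0 T) a :=
    isSmoothSpaceTimeOn_activity hE.smooth_density hRfcd hηr ha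
  have hpos : ∀ s ∈ Ico 0 T, ∀ x, 0 < a s x := fun s hs x => by
    rw [ha]
    exact mul_pos (hE.density_pos s hs x) (one_pos.trans_le (hRf1 s hs x))
  have hac : ∀ s ∈ Ico 0 T, Continuous (a s) := fun s hs => (hsm.isSmooth_slice hs).continuous
  have hZpos : ∀ N : ℕ, ∀ s ∈ Ico 0 T, 0 < posPartition (a s) (hsDiameter σ N) (N + 1) := fun N s hs =>
    posPartition_pos (hac s hs) (hpos s hs) hσ2.le N
  -- (iv) `Cst` through the analytic compressibility, and its continuity
  have hCst : ∀ s ∈ Ico 0 T, Cst s =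
      ∫ x, ρ s x * (σ ^ 3 * ρ s x) * deriv Zs (σ ^ 3 * ρ s x) * Torus.divergence (u s) x := by
    intro s hs
    refine integral_congr_ae (ae_of_all _ fun x => ?_)
    show ρ s x * (ρ s x * σ ^ 3) * deriv hsCompressibility (ρ s x * σ ^ 3) * Torus.divergence (u s) x = _
    rw [mul_comm (ρ s x) (σ ^ 3), hZd _ (hη s hs x)]
  have hCst_cont : ContinuousOn Cst (Icc 0 t) := by
    have hσρ : Torus.IsSmoothSpaceTimeOn (Ico 0 T) (fun s x => σ ^ 3 * ρ s x) :=
      (Torus.isSmoothSpaceTimeOn_const (Torus.isSmooth_const (σ ^ 3)) _).mul hE.smooth_density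
    have hI : Torus.IsSmoothSpaceTimeOn (Ico 0 T)
        (fun s x => ρ s x * (σ ^ 3 * ρ s x) * deriv Zs (σ ^ 3 * ρ s x) * Torus.divergence (u s) x) :=
      ((hE.smooth_density.mul hσρ).mul (hσρ.comp_contDiffOn hZ'cd hηV)).mul (hE.smooth_velocity.divergence hU)
    refine ((hI.continuousOn_integral (convex_Ico 0 T)).mono htT).congr fun s hs => ?_
    exact hCst s (htT hs)
  -- the logarithmic time derivative `∂_s a / a = (Zs + ηZs′)(σ³ρ) ∂_s ρ / ρ`
  have hlog : ∀ s ∈ Ico 0 T, ∀ x, Torus.timeDerivWithin (Ico 0 T) a s x / a s x =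
      (Zs (σ ^ 3 * ρ s x) + σ ^ 3 * ρ s x * deriv Zs (σ ^ 3 * ρ s x)) *
        (Torus.timeDerivWithin (Ico 0 T) ρ s x / ρ s x) := by
    intro s hs x
    rw [timeDerivWithin_activity_div hE.smooth_density hs (hU s hs) x ha (hRfd _ (hη s hs x))
      (hE.density_pos s hs x).ne' (one_pos.trans_le (hRf1 s hs x)).ne', hid _ (hη s hs x)]
  refine ⟨hsm, hpos, hZpos, hCst_cont, ?_, ?_⟩
  · -- (v) the uniform bound of the canonical means on `[0, t]`: `|∂_s a / a| ≤ M` on the compact slab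
    obtain ⟨M, hM⟩ := ((hsm.timeDerivWithin hU).mul
      (ClampedCurrentsDockLogPartition.isSmoothSpaceTimeOn_inv hsm hpos)).exists_norm_le_of_isCompact
        isCompact_Icc htT
    refine ⟨M, fun N s hs => ?_⟩
    have hχ : ∀ y, |Torus.timeDerivWithin (Ico 0 T) a s y / a s y| ≤ M := fun y => by
      rw [div_eq_mul_inv, ← Real.norm_eq_abs]
      exact hM s hs y
    exact abs_mean_sum_le (χ := fun y => Torus.timeDerivWithin (Ico 0 T) a s y / a s y) (hac s (htT hs))
      (hpos s (htT hs)) hσ2.le hχ N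
  · -- (vi) the limit of the canonical means
    intro s hs
    have hsT : s ∈ Ico 0 T := htT hs
    have hρc : Continuous (ρ s) := (hE.smooth_density.isSmooth_slice hsT).continuous
    have hρ0 : ∀ x, 0 < ρ s x := hE.density_pos s hsT
    -- packing from the guard, activity inversion: `rhoLim (profileOf (a s)) σ = ρ s` in the statics regime
    have hpack : σ ^ 3 * (⨆ x, ρ s x) ≤
        min (r / (2 * (2 * (2 * Real.exp 1 + 1)))) (1 / (64 * Real.exp 1 * v₁)) := by
      have h1 : ∀ x, ρ s x ≤ min ηA η₁ / σ ^ 3 := fun x => by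
        rw [le_div_iff₀ hσ3]
        exact (hguard s hsT x).le
      calc σ ^ 3 * (⨆ x, ρ s x) ≤ σ ^ 3 * (min ηA η₁ / σ ^ 3) :=
            mul_le_mul_of_nonneg_left (ciSup_le h1) hσ3.le
        _ = min ηA η₁ := mul_div_cancel₀ _ hσ3.ne'
        _ ≤ ηA := min_le_left _ _
    obtain ⟨hac', ha0', -, hsmall, hlim⟩ :=
      EntropyClockDock.activity_of_density hr hsol hbd hcont huniq hσ hσ2 hρc hρ0 (hmass s hsT) hpack
    -- continuity of `χ_s = ∂_s log a_s`
    have hχc : Continuous fun y => Torus.timeDerivWithin (Ico 0 T) a s y / a s y :=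
      (ClampedCurrentsDockLogPartition.continuous_timeDerivWithin_slice hsm hsT).div (hac s hsT)
        fun y => (hpos s hsT y).ne'
    -- the calculus identity `∫ χ_s ρ_s = -Cst s` (continuity equation + the divergence identity)
    have hcalc : ∫ y, Torus.timeDerivWithin (Ico 0 T) a s y / a s y * ρ s y = -Cst s := by
      have hpt : ∀ y, Torus.timeDerivWithin (Ico 0 T) a s y / a s y * ρ s y =
          -((Zs (σ ^ 3 * ρ s y) + σ ^ 3 * ρ s y * deriv Zs (σ ^ 3 * ρ s y)) *
            Torus.divergence (fun z => ρ s z • u s z) y) := by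
        intro y
        have hm : Torus.timeDerivWithin (Ico 0 T) ρ s y = -Torus.divergence (fun z => ρ s z • u s z) y := by
          linarith [hE.mass s hsT y]
        rw [hlog s hsT y, mul_assoc, div_mul_cancel₀ _ (hρ0 y).ne', hm, mul_neg]
      simp_rw [hpt]
      rw [integral_neg, static_integral_identity (hE.smooth_density.isSmooth_slice hsT)
        (hE.smooth_velocity.isSmooth_slice hsT) isOpen_Ioo hZcd (hηV s hsT), hCst s hsT]
    have key := tendsto_mean_sum_div hac' ha0' hsmall hχc
    rw [hlim, hcalc] at key
    exact key

end Summit.AtomisticToContinuum.HydrodynamicLimit.Theorems.ClampedCurrentsDockStaticLimit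

end
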